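import Summits.Schanuel.Schanuel.Theses.RoyCriterion
import Summits.Schanuel.Schanuel.Theorems.RoyCriterionSchanuelTwoLineSketch
import Summits.Schanuel.Schanuel.Theorems.RoyCriterionSchanuelTwoStubLogRichSector
import Summits.Schanuel.Schanuel.Theorems.RoyCriterionSchanuelTwoStubGridRichSector
import Summits.Schanuel.Schanuel.Theorems.RoyCriterionSchanuelTwoStubNesterenkoPlanes
import Summits.Schanuel.Schanuel.Theorems.RoyCriterionSchanuelTwoStubEclReduction
import Summits.Schanuel.Schanuel.Theorems.RoyCriterionSchanuelTwoStubModularSector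
import Summits.Schanuel.Schanuel.Theorems.RoyCriterionSchanuelTwoStubGridExpSector
import Summits.Schanuel.Schanuel.Theorems.RoyCriterionSchanuelTwoStubPeriodSector
import Literature.NumberTheory.Transcendental.LindemannWeierstrassProofs

-- `Summit.Schanuel.Schanuel.…` is the mandated layout of this single-problem summit (CONVENTIONS §1).
set_option linter.dupNamespace false

/-!
# Route `RoyCriterion`, crux `SchanuelTwo` (stmt-Schanuel-0069) — line `CardA_BW`: the sector atlas and its residual

`SchanuelTwo` (`Summit.Schanuel.Schanuel.Theses.RoyCriterion.SchanuelTwo`) is Schanuel's conjecture for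
`n = 2`: for `x : Fin 2 → ℂ` linearly independent over `ℚ`, `2 ≤ trdeg_ℚ K_x`, `K_x = ℚ(x, e^x)`
(Lang 1966; Waldschmidt 2000 §1.4; open). Line `CardA_BW` of the crux chain (idea `bw-log-rich-planes`,
crux-ideate r2 ideator 5; second line `CardB_Scale` absorbed) is a SECTOR ATLAS: every engine of the tree
that outputs "transcendence degree `≥ 2`" is turned into a sector of the space of pairs — a configuration
ALGEBRAIC OVER `K_x` on which the engine fires, adjoined to `K_x` at no cost in transcendence degree —
and each sector was landed as a registered stub (all sorry-free, all `--supports stmt-Schanuel-0069`):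

* Lindemann–Weierstrass (`x ∈ ℚ̄²`; p87563 `stub_purityAlgebraic`, re-derived inline below) and the
  Hermite–Lindemann collapse (a coordinate with `trdeg ℚ(xᵢ, e^{xᵢ}) ≠ 1`; p89549);
* `stub_logRichSector` (Brownawell–Waldschmidt: two logarithms of algebraic numbers and an irrational
  multiplier; p98157), `stub_gridRichSector` / `stub_gridExpSector` (LNM 1752 Ch. 14 Thm 2.9, clauses
  `t₂` / `t`, `t₁`: `d × ℓ` grids; p98594 / p100720), `stub_nesterenkoPlanes` (planes through `π`, `π√3`;
  p98250), `stub_modularSector` (Nesterenko 1996 Thm 1.1: `q` and two of `P(q), Q(q), R(q)`; p100772),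
  `stub_periodSector` (Tubbs 1990 Thm 4: a lattice basis, its invariants, a scale and `e^{cωᵢ}`; p102652,
  unconditional by `Tubbs1990_thm4_periods_holds`), and the outer transfer `stub_eclReduction` (Kirby 2010
  Prop. 7.2 at rank 2: it suffices to treat pairs from `ecl(∅)`; p98381).

This file records, kernel-checked and WITHOUT definitions, what the atlas leaves:

* §1 `schanuelTwo_iff_offAtlas` — **the crux is equivalent to its restriction to the residual**: `ℚ`-free
  pairs of depth-one seeds from `ecl(∅)`, with a transcendental coordinate, lying in NONE of the seven
  sectors. (`→` restriction; `←` the composition of the line's skeleton `Lines/CardA_BW.lean` with every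
  landed stub.) The residual is therefore exactly as hard as the crux: the line's registered stub `stub_rest`.
* §2 `expOnePiAlgebraicIndependent_of_offAtlas` — the residual alone implies the algebraic independence of
  `e` and `π` (registered open statement `Literature.NumberTheory.Transcendental.ExpOnePiAlgebraicIndependent`),
  so no proof of `stub_rest` avoids that open problem; whether the named instances `(1, πi)`, `(1, e)`,
  `(log 2, √2 log 2)`, `(πi, log 2)` lie in a sector is itself an open independence question (under Schanuel's
  conjecture they lie in none), which is why the implication goes through the crux and not through a
  membership computation.

In the statements the residual hypothesis is written with a bound field `K` and the equation
`K = IntermediateField.adjoin ℚ (range x ∪ range (exp ∘ x))`, and the sector predicates of the skeleton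
(`LogRich`, `GridRich`, `NesterenkoPlane`, `ModularRich`, `GridExpRich`, `PeriodRich`, `DepthOnePair`) are
unfolded verbatim.
-/

noncomputable section

open Complex IntermediateField
open Literature.Barriers.Schanuel (trdeg_mono ramanujanP ramanujanQ ramanujanR)
open Literature.NumberTheory.Transcendental (ecl)
open Summit.Schanuel.Schanuel.Theses.RoyCriterion (SchanuelTwo)

namespace Summit.Schanuel.Schanuel.Theorems

/-! ### §1 The crux is equivalent to its off-atlas residual -/

/-- **`SchanuelTwo` ⟺ the off-atlas residual of line `CardA_BW`** (the registered stub `stub_rest`, spelled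
out): Schanuel's conjecture for `n = 2` holds iff it holds for every `ℚ`-linearly independent pair `x` of
exponentially algebraic numbers (`xᵢ ∈ ecl ∅`) with a transcendental coordinate, both coordinates depth-one
seeds (`trdeg ℚ(xᵢ, e^{xᵢ}) = 1`), such that `K = ℚ(x, e^x)` carries, algebraically over it, NO
Brownawell–Waldschmidt configuration, NO Thm 2.9 grid (clauses `t₂`; `t`, `t₁`), NO Nesterenko nome `q`
with two of `P(q), Q(q), R(q)`, NO lattice basis with invariants, scale and `e^{cωᵢ}`, and whose `ℚ`-plane
avoids `π` and `π√3`. `→`: restriction. `←`: Kirby's reduction (`stub_eclReduction`), then pointwise the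
Hermite–Lindemann collapse, Lindemann–Weierstrass, and the seven landed sector theorems.
[cite: Kirby2010EAEF, Prop. 7.2] [cite: NesterenkoPhilippon2001, Ch. 14 Theorem 2.9; Ch. 3 Theorem 1.1]
[cite: BakerTNT1975, Ch. 12 Theorem 12.2] [cite: Tubbs1990, Thm 4 (p. 112) and Remark p. 114] -/
theorem schanuelTwo_iff_offAtlas :
    SchanuelTwo ↔
      ∀ (x : Fin 2 → ℂ) (K : IntermediateField ℚ ℂ),
        K = IntermediateField.adjoin ℚ (Set.range x ∪ Set.range (Complex.exp ∘ x)) →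
        (∀ i, x i ∈ ecl (∅ : Set ℂ)) → LinearIndependent ℚ x → (∃ i, Transcendental ℚ (x i)) →
        (∀ i, Algebra.trdeg ℚ ↥(IntermediateField.adjoin ℚ ({x i, Complex.exp (x i)} : Set ℂ)) = 1) →
        (¬ ∃ l₁ l₂ μ : ℂ, IsAlgebraic ℚ (Complex.exp l₁) ∧ IsAlgebraic ℚ (Complex.exp l₂) ∧
            LinearIndependent ℚ ![l₁, l₂] ∧ LinearIndependent ℚ ![(1 : ℂ), μ] ∧
            IsAlgebraic K l₁ ∧ IsAlgebraic K l₂ ∧ IsAlgebraic K μ ∧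
            IsAlgebraic K (Complex.exp (μ * l₁)) ∧ IsAlgebraic K (Complex.exp (μ * l₂))) →
        (¬ ∃ (d l : ℕ) (X : Fin d → ℂ) (Y : Fin l → ℂ), l + d < d * l ∧ LinearIndependent ℚ X ∧
            LinearIndependent ℚ Y ∧ (∀ i, IsAlgebraic K (X i)) ∧ (∀ j, IsAlgebraic K (Y j)) ∧
            ∀ i j, IsAlgebraic K (Complex.exp (X i * Y j))) →
        (¬ ((Real.pi : ℂ) ∈ Submodule.span ℚ (Set.range x) ∨
            ((Real.pi * Real.sqrt 3 : ℝ) : ℂ) ∈ Submodule.span ℚ (Set.range x))) →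
        (¬ ∃ q u v w : ℂ, 0 < ‖q‖ ∧ ‖q‖ < 1 ∧
            ({u, v, w} : Set ℂ) = {ramanujanP q, ramanujanQ q, ramanujanR q} ∧
            IsAlgebraic K q ∧ IsAlgebraic K u ∧ IsAlgebraic K v) →
        (¬ ∃ (d l : ℕ) (X : Fin d → ℂ) (Y : Fin l → ℂ), 1 ≤ d ∧ 1 ≤ l ∧ LinearIndependent ℚ X ∧
            LinearIndependent ℚ Y ∧ (∀ i j, IsAlgebraic K (Complex.exp (X i * Y j))) ∧
            (2 * (l + d) ≤ d * l ∨ (d + 2 * l ≤ d * l ∧ ∀ i, IsAlgebraic K (X i)))) →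
        (¬ ∃ (L : PeriodPair) (c : ℂ), c ≠ 0 ∧ IsAlgebraic K L.g₂ ∧ IsAlgebraic K L.g₃ ∧
            IsAlgebraic K L.ω₁ ∧ IsAlgebraic K L.ω₂ ∧ IsAlgebraic K c ∧
            IsAlgebraic K (Complex.exp (c * L.ω₁)) ∧ IsAlgebraic K (Complex.exp (c * L.ω₂))) →
        (2 : Cardinal) ≤ Algebra.trdeg ℚ K := by
  constructor
  · intro hS x K hK _ hx _ _ _ _ _ _ _ _
    subst hK
    exact hS x hx
  · intro hrest
    refine stub_eclReduction fun x hecl hx => ?_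
    set K := IntermediateField.adjoin ℚ (Set.range x ∪ Set.range (Complex.exp ∘ x)) with hK
    -- Hermite–Lindemann collapse: a coordinate that is not a depth-one seed settles `x`.
    by_cases hD : ∀ i, Algebra.trdeg ℚ ↥(adjoin ℚ ({x i, cexp (x i)} : Set ℂ)) = 1
    swap
    · push Not at hD
      obtain ⟨i, hi⟩ := hD
      have h2 : (2 : Cardinal) ≤ Algebra.trdeg ℚ ↥(adjoin ℚ ({x i, cexp (x i)} : Set ℂ)) :=
        (schanuelTwo_two_le_iff_ne_one (schanuelTwo_one_le_trdeg_seed (hx.ne_zero i))).mpr hi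
      exact h2.trans (trdeg_mono (schanuelTwo_adjoin_seed_le x i))
    -- Lindemann–Weierstrass: both coordinates algebraic.
    by_cases halg : ∀ i, IsAlgebraic ℚ (x i)
    · have hind : AlgebraicIndependent ℚ (fun i => cexp (x i)) :=
        Literature.NumberTheory.Transcendental.algebraicIndependent_exp_holds x halg hx
      let y : Fin 2 → K := fun i => ⟨cexp (x i), subset_adjoin ℚ _ (Or.inr ⟨i, rfl⟩)⟩
      have hy : AlgebraicIndependent ℚ y := AlgebraicIndependent.of_comp K.val hind
      simpa using hy.cardinalMk_le_trdeg
    push Not at halg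
    obtain ⟨i₀, hi₀⟩ := halg
    -- The seven sectors.
    by_cases hA : ∃ l₁ l₂ μ : ℂ, IsAlgebraic ℚ (cexp l₁) ∧ IsAlgebraic ℚ (cexp l₂) ∧
        LinearIndependent ℚ ![l₁, l₂] ∧ LinearIndependent ℚ ![(1 : ℂ), μ] ∧
        IsAlgebraic K l₁ ∧ IsAlgebraic K l₂ ∧ IsAlgebraic K μ ∧
        IsAlgebraic K (cexp (μ * l₁)) ∧ IsAlgebraic K (cexp (μ * l₂))
    · obtain ⟨l₁, l₂, μ, ha1, ha2, hli, hirr, hl1, hl2, hμ, hm1, hm2⟩ := hA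
      exact stub_logRichSector x l₁ l₂ μ ha1 ha2 hli hirr hl1 hl2 hμ hm1 hm2
    by_cases hB : ∃ (d l : ℕ) (X : Fin d → ℂ) (Y : Fin l → ℂ), l + d < d * l ∧ LinearIndependent ℚ X ∧
        LinearIndependent ℚ Y ∧ (∀ i, IsAlgebraic K (X i)) ∧ (∀ j, IsAlgebraic K (Y j)) ∧
        ∀ i j, IsAlgebraic K (cexp (X i * Y j))
    · obtain ⟨d, l, X, Y, hdl, hX, hY, hXa, hYa, hE⟩ := hB
      exact stub_gridRichSector x d l X Y hdl hX hY hXa hYa hE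
    by_cases hC : (Real.pi : ℂ) ∈ Submodule.span ℚ (Set.range x) ∨
        ((Real.pi * Real.sqrt 3 : ℝ) : ℂ) ∈ Submodule.span ℚ (Set.range x)
    · exact stub_nesterenkoPlanes x hC
    by_cases hM : ∃ q u v w : ℂ, 0 < ‖q‖ ∧ ‖q‖ < 1 ∧
        ({u, v, w} : Set ℂ) = {ramanujanP q, ramanujanQ q, ramanujanR q} ∧
        IsAlgebraic K q ∧ IsAlgebraic K u ∧ IsAlgebraic K v
    · obtain ⟨q, u, v, w, hq0, hq1, huvw, hq, hu, hv⟩ := hM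
      exact stub_modularSector x q u v w hq0 hq1 huvw hq hu hv
    by_cases hG : ∃ (d l : ℕ) (X : Fin d → ℂ) (Y : Fin l → ℂ), 1 ≤ d ∧ 1 ≤ l ∧ LinearIndependent ℚ X ∧
        LinearIndependent ℚ Y ∧ (∀ i j, IsAlgebraic K (cexp (X i * Y j))) ∧
        (2 * (l + d) ≤ d * l ∨ (d + 2 * l ≤ d * l ∧ ∀ i, IsAlgebraic K (X i)))
    · obtain ⟨d, l, X, Y, hd, hl, hX, hY, hE, hnum⟩ := hG
      exact stub_gridExpSector x d l X Y hd hl hX hY hE hnum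
    by_cases hP : ∃ (L : PeriodPair) (c : ℂ), c ≠ 0 ∧ IsAlgebraic K L.g₂ ∧ IsAlgebraic K L.g₃ ∧
        IsAlgebraic K L.ω₁ ∧ IsAlgebraic K L.ω₂ ∧ IsAlgebraic K c ∧
        IsAlgebraic K (cexp (c * L.ω₁)) ∧ IsAlgebraic K (cexp (c * L.ω₂))
    · obtain ⟨L, c, hc, h2, h3, hw1, hw2, hca, he1, he2⟩ := hP
      exact stub_periodSector Literature.NumberTheory.Transcendental.Tubbs1990_thm4_periods_holds
        x L c hc h2 h3 hw1 hw2 hca he1 he2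
    exact hrest x K hK hecl hx ⟨i₀, hi₀⟩ hD hA hB hC hM hG hP

/-! ### §2 The residual implies the algebraic independence of `e` and `π` -/

/-- **The off-atlas residual of line `CardA_BW` implies that `e` and `π` are algebraically independent**
(registered open statement `Literature.NumberTheory.Transcendental.ExpOnePiAlgebraicIndependent`; Lang 1966,
Waldschmidt 2000 §1.4: open — even the irrationality of `e + π` is unknown). Route: residual ⟹ `SchanuelTwo`
(§1) ⟹ the crux at `x = (1, πi)` (p89549 `expOnePiAlgebraicIndependent_of_schanuelTwo`). Consequently the
line's last stub `stub_rest` is at least as hard as this open problem, whatever the sector membership of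
`(1, πi)` turns out to be. [cite: BakerTNT1975, Ch. 12 p. 120] -/
theorem expOnePiAlgebraicIndependent_of_offAtlas
    (hrest : ∀ (x : Fin 2 → ℂ) (K : IntermediateField ℚ ℂ),
        K = IntermediateField.adjoin ℚ (Set.range x ∪ Set.range (Complex.exp ∘ x)) →
        (∀ i, x i ∈ ecl (∅ : Set ℂ)) → LinearIndependent ℚ x → (∃ i, Transcendental ℚ (x i)) →
        (∀ i, Algebra.trdeg ℚ ↥(IntermediateField.adjoin ℚ ({x i, Complex.exp (x i)} : Set ℂ)) = 1) →
        (¬ ∃ l₁ l₂ μ : ℂ, IsAlgebraic ℚ (Complex.exp l₁) ∧ IsAlgebraic ℚ (Complex.exp l₂) ∧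
            LinearIndependent ℚ ![l₁, l₂] ∧ LinearIndependent ℚ ![(1 : ℂ), μ] ∧
            IsAlgebraic K l₁ ∧ IsAlgebraic K l₂ ∧ IsAlgebraic K μ ∧
            IsAlgebraic K (Complex.exp (μ * l₁)) ∧ IsAlgebraic K (Complex.exp (μ * l₂))) →
        (¬ ∃ (d l : ℕ) (X : Fin d → ℂ) (Y : Fin l → ℂ), l + d < d * l ∧ LinearIndependent ℚ X ∧
            LinearIndependent ℚ Y ∧ (∀ i, IsAlgebraic K (X i)) ∧ (∀ j, IsAlgebraic K (Y j)) ∧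
            ∀ i j, IsAlgebraic K (Complex.exp (X i * Y j))) →
        (¬ ((Real.pi : ℂ) ∈ Submodule.span ℚ (Set.range x) ∨
            ((Real.pi * Real.sqrt 3 : ℝ) : ℂ) ∈ Submodule.span ℚ (Set.range x))) →
        (¬ ∃ q u v w : ℂ, 0 < ‖q‖ ∧ ‖q‖ < 1 ∧
            ({u, v, w} : Set ℂ) = {ramanujanP q, ramanujanQ q, ramanujanR q} ∧
            IsAlgebraic K q ∧ IsAlgebraic K u ∧ IsAlgebraic K v) →
        (¬ ∃ (d l : ℕ) (X : Fin d → ℂ) (Y : Fin l → ℂ), 1 ≤ d ∧ 1 ≤ l ∧ LinearIndependent ℚ X ∧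
            LinearIndependent ℚ Y ∧ (∀ i j, IsAlgebraic K (Complex.exp (X i * Y j))) ∧
            (2 * (l + d) ≤ d * l ∨ (d + 2 * l ≤ d * l ∧ ∀ i, IsAlgebraic K (X i)))) →
        (¬ ∃ (L : PeriodPair) (c : ℂ), c ≠ 0 ∧ IsAlgebraic K L.g₂ ∧ IsAlgebraic K L.g₃ ∧
            IsAlgebraic K L.ω₁ ∧ IsAlgebraic K L.ω₂ ∧ IsAlgebraic K c ∧
            IsAlgebraic K (Complex.exp (c * L.ω₁)) ∧ IsAlgebraic K (Complex.exp (c * L.ω₂))) →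
        (2 : Cardinal) ≤ Algebra.trdeg ℚ K) :
    Literature.NumberTheory.Transcendental.ExpOnePiAlgebraicIndependent :=
  expOnePiAlgebraicIndependent_of_schanuelTwo (schanuelTwo_iff_offAtlas.mpr hrest)

end Summit.Schanuel.Schanuel.Theorems

end
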